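import Summits.BirchSwinnertonDyer.BirchSwinnertonDyer.Theorems.EisensteinPrimesMazurMCOnCellBEtaleEndLocalSplitting
import HarnessLib

/-!
# Crux `MazurMCOnCellB` (stmt-BirchSwinnertonDyer-19033), line `mudescent` v4 — local `p`-torsion at
# the étale end, RANK-FREE: a split multiplicative odd `p` with an unramified rational line has
# `E(ℚ_p)[p] ≠ 0` (rows A10 = X2b AND B11 = X2c)

Width seat bsd-line-x2-p1-w2 (gen 5), `--supports -19033`, μ-lineage; sequel of
`…MazurMCOnCellBEtaleEndLocalSplitting` (§3 there: the `X2.CellB` forms). THEOREMS ONLY (no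
definition, no named fact, no `sorry`); nothing here proves a main conjecture, closes a stub or
moves a label. The rank hypothesis of `X2.CellB` is idle for the local `p`-torsion statements; this
file gives them for `W/ℚ` globally minimal, `p` odd SPLIT multiplicative and ANY rational `p`-line
`Φ` UNRAMIFIED at `p` — hence also at the étale end of an X2c class (row B11, crux `BSDpOnCellC` =
stmt-BirchSwinnertonDyer-19034, whose line `b1` has a control-theorem residual on the sub-row
`p ∣ c_p(E)` precisely because `E(ℚ_p)[p]` may be non-zero there: at the split étale end it IS
non-zero, so the torsion-free control theorems `X2/MultControlNoLocalTorsion` never apply to that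
member).

* §1 `decomp_fix_of_lineUnramifiedAt_of_split` — `D_v` fixes an unramified rational line pointwise at
  a SPLIT `p` (rank-free form of `…EtaleEndAtP.decomp_fix_of_offLocus_of_split`; here from the local
  splitting: the alternative «`D_v` trivial on `E[p]/Φ`» of `TateLineDecomposition.fix_or_quot_of_split`
  (A40, discharged) would make `I_v` fix the Tate `μ`-line `X₀ ≅ E[p]/Φ`).
* §2 `exists_point_adicCompletion_ne_zero_of_lineUnramifiedAt_of_split`,
  `exists_localTorsion_ne_zero_of_lineUnramifiedAt_of_split` — **`E(ℚ_p)[p] ≠ 0`** (Galois descent of a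
  non-zero point of `Φ`; Mathlib `Padic.adicCompletionEquiv`); packagings
  `…_of_notGVPar_offLocus_of_split` (type A off the barrier locus, any rank),
  `…_of_cellC_offLocus_of_split` (row B11) and the dichotomy
  `exists_localTorsion_ne_zero_iff_split_of_cellC_offLocus` (**`E₀(ℚ_p)[p] ≠ 0 ⟺ p` split** at an X2c
  type-A étale end; `⟹` = tree `X11b.LocalTorsion.localTorsion_eq_zero_of_nonsplit`);
  `not_noLocalPTorsion_of_lineUnramifiedAt_of_split` records that hypothesis (iv) «`E(ℚ_p)[p] = 0`»
  (Castella 2018 erratum Thm. 1.1 (iv); the `hlt`-atoms of `X2/MultControlAtomsNoLocalTorsion`) FAILS.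

HONEST FRAMING: local structure only; no control theorem, main conjecture or BSD statement is proved;
0 cells / labels / stubs move. References: [GreenbergVatsal2000] §2 pp. 14–15; [SilvermanATAEC1994]
§V.5 Thm. 5.3, §V.6 Prop. 6.1; [Castella2018Erratum] Thm. 1.1 (iv); [SilvermanAEC2009] VII.6.1.
-/

set_option autoImplicit false

-- `Summit.BirchSwinnertonDyer.BirchSwinnertonDyer.…`: the summit and its single sub-problem share a name (D-0017 layout).
set_option linter.dupNamespace false

noncomputable section

open scoped Classical NumberField

open WeierstrassCurve NumberField IsDedekindDomain Field
  Literature.NumberTheory.EllipticCurves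
  Literature.NumberTheory.EllipticCurves.Rank1Residual
  Literature.NumberTheory.GaloisRepresentations
  Literature.NumberTheory.EllipticCurves.GreenbergSelmer
  Literature.Barriers.BirchSwinnertonDyer
  Summit.BirchSwinnertonDyer.Rank1Residual
  Summit.BirchSwinnertonDyer.BirchSwinnertonDyer.Theorems.EisensteinPrimesMazurMCOnCellBEtaleEndLocalSplitting

namespace Summit.BirchSwinnertonDyer.BirchSwinnertonDyer.Theorems.EisensteinPrimesMazurMCOnCellBEtaleEndLocalTorsion

variable {W : WeierstrassCurve ℚ} [W.IsElliptic] [W.IsGloballyMinimal] {p : ℕ} [hp : Fact p.Prime]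

/-! ## §1 At a SPLIT `p` the decomposition group fixes an unramified rational line pointwise -/

/-- **SPLIT `p`, unramified rational line `Φ`: `D_v` fixes `Φ` pointwise** (`φ|_{G_p} = 1`; any rank,
any parity). By `TateLineDecomposition.fix_or_quot_of_split` (Tate uniformisation A40, DISCHARGED
`TateCurve.Silverman1994_thmV53_tateUniformisation_holds`) the alternative is «`D_v` acts trivially on
`E[p]/Φ`»; but then the inertia element moving the Tate `μ`-line `X₀` of the local splitting
(`exists_tateLine_compl_of_lineUnramifiedAt_of_mult`: `X₀` is `D_v`-stable and `Φ ⊓ X₀ = ⊥`) would fix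
it. [cite: GreenbergVatsal2000, §2 pp. 14–15] [cite: SilvermanATAEC1994, §V.5 Thm. 5.3] -/
theorem decomp_fix_of_lineUnramifiedAt_of_split (hp2 : p ≠ 2)
    (hsplit : W.HasSplitMultiplicativeReductionAtPrime p)
    {Φ : AddSubgroup (geomTorsion W (p : ℤ))} (hΦ : IsRationalLine W p Φ)
    (hunr : LineUnramifiedAt W p Φ) {v : HeightOneSpectrum (𝓞 ℚ)} (hpv : (p : 𝓞 ℚ) ∈ v.asIdeal) :
    ∀ g ∈ decomp (K := ℚ) v, ∀ P ∈ Φ, g • P = P := by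
  obtain ⟨X, -, hXst, hΦX, -, ⟨τ, hτ, Q, hQX, hτQ⟩, -⟩ :=
    exists_tateLine_compl_of_lineUnramifiedAt_of_mult hp2 hsplit.hasMultiplicativeReductionAtPrime hΦ
      hunr hpv
  rcases X2.TateLineDecomposition.fix_or_quot_of_split W p
      TateCurve.Silverman1994_thmV53_tateUniformisation_holds hsplit hpv hΦ.1
      (fun g _ P hP ↦ hΦ.2 g P hP) with hfix | hquot
  · exact hfix
  · exfalso
    have hτD : τ ∈ decomp (K := ℚ) v := inertia_le_decomp v hτ
    have hmem : τ • Q - Q ∈ Φ ⊓ X := ⟨hquot τ hτD Q, X.sub_mem (hXst τ hτD Q hQX) hQX⟩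
    rw [hΦX, AddSubgroup.mem_bot, sub_eq_zero] at hmem
    exact hτQ hmem

/-! ## §2 `E(ℚ_p)[p] ≠ 0` at a split multiplicative odd `p` with an unramified rational line -/

/-- **`E(ℚ_v)[p] ≠ 0`** (`v ∋ p`) for `W/ℚ` globally minimal, `p` odd SPLIT multiplicative and a
rational `p`-line `Φ` unramified at `p`: a non-zero point of `Φ`, carried to `E(ℚ̄_v)`, is fixed by
`Γ_{ℚ_v}` (§1) and descends to `E(ℚ_v)` (tree `exists_map_eq_of_forall_smul_localPoints_eq`). Rank-free
form of `…EtaleEndLocalSplitting.exists_point_adicCompletion_ne_zero_of_cellB_offLocus_of_split`.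
[cite: GreenbergVatsal2000, §2 pp. 14–15] [cite: SilvermanATAEC1994, §V.5 Thm. 5.3] -/
theorem exists_point_adicCompletion_ne_zero_of_lineUnramifiedAt_of_split (hp2 : p ≠ 2)
    (hsplit : W.HasSplitMultiplicativeReductionAtPrime p)
    {Φ : AddSubgroup (geomTorsion W (p : ℤ))} (hΦ : IsRationalLine W p Φ)
    (hunr : LineUnramifiedAt W p Φ) {v : HeightOneSpectrum (𝓞 ℚ)} (hpv : (p : 𝓞 ℚ) ∈ v.asIdeal) :
    ∃ R : (W.baseChange (v.adicCompletion ℚ)).toAffine.Point, R ≠ 0 ∧ p • R = 0 := by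
  have hfix := decomp_fix_of_lineUnramifiedAt_of_split hp2 hsplit hΦ hunr hpv
  obtain ⟨P₀, hP₀Φ, hP₀0⟩ :=
    EisensteinPrimesMazurMCOnCellBEtaleEndAtP.exists_ne_zero_of_isRationalLine hΦ
  set Q : localPoints W (v.adicCompletion ℚ) :=
    pointsMap W (v.adicCompletion ℚ) (P₀ : W.geomPoints) with hQ
  have hQfix : ∀ τ : absoluteGaloisGroup (v.adicCompletion ℚ), τ • Q = Q := fun τ ↦ by
    have hmem : absGaloisRestrict ℚ (v.adicCompletion ℚ) τ ∈ decomp (K := ℚ) v := by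
      rw [mem_decomp_iff]; exact ⟨τ, rfl⟩
    have h1 : absGaloisRestrict ℚ (v.adicCompletion ℚ) τ • P₀ = P₀ := hfix _ hmem P₀ hP₀Φ
    rw [hQ, ← pointsMap_smul, resGal_eq_absGaloisRestrict]
    exact congrArg _ (congrArg Subtype.val h1)
  have hQ0 : Q ≠ 0 := fun h ↦ hP₀0 (by
    apply Subtype.ext
    exact pointsMapOfEmb_injective W _ (h.trans (map_zero _).symm))
  have hQp : p • Q = 0 := by
    rw [hQ, ← map_nsmul, ← AddSubmonoidClass.coe_nsmul, AddSubgroup.torsionBy.nsmul P₀,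
      ZeroMemClass.coe_zero, map_zero]
  haveI : PerfectField (v.adicCompletion ℚ) :=
    @PerfectField.ofCharZero _ _ (charZero_adicCompletion v)
  obtain ⟨R, hR⟩ := exists_map_eq_of_forall_smul_localPoints_eq W (v.adicCompletion ℚ) hQfix
  refine ⟨R, by rintro rfl; exact hQ0 (hR.symm.trans (map_zero _)), ?_⟩
  apply WeierstrassCurve.Affine.Point.map_injective
    (f := IsScalarTower.toAlgHom ℚ (v.adicCompletion ℚ) (AlgebraicClosure (v.adicCompletion ℚ)))
  rw [map_nsmul, hR, map_zero]
  exact hQp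

/-- **`E(ℚ_p)[p] ≠ 0`** for `W/ℚ` globally minimal, `p` odd SPLIT multiplicative and a rational
`p`-line unramified at `p` (`ℚ_p`-point form, Mathlib `Padic.adicCompletionEquiv`). Any rank.
[cite: GreenbergVatsal2000, §2 pp. 14–15] [cite: SilvermanATAEC1994, §V.5 Thm. 5.3, §V.6 Prop. 6.1] -/
theorem exists_localTorsion_ne_zero_of_lineUnramifiedAt_of_split (hp2 : p ≠ 2)
    (hsplit : W.HasSplitMultiplicativeReductionAtPrime p)
    {Φ : AddSubgroup (geomTorsion W (p : ℤ))} (hΦ : IsRationalLine W p Φ)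
    (hunr : LineUnramifiedAt W p Φ) :
    ∃ R : (W.baseChange ℚ_[p]).toAffine.Point, R ≠ 0 ∧ p • R = 0 := by
  obtain ⟨R, hR0, hRp⟩ := exists_point_adicCompletion_ne_zero_of_lineUnramifiedAt_of_split hp2 hsplit
    hΦ hunr (KernelDisc.natCast_mem_asIdeal_primesEquiv_symm (p := p))
  let e : ((Rat.HeightOneSpectrum.primesEquiv (R := 𝓞 ℚ)).symm ⟨p, Fact.out⟩).adicCompletion ℚ
      →ₐ[ℚ] ℚ_[p] :=
    ((Padic.adicCompletionEquiv (R := 𝓞 ℚ) ⟨p, Fact.out⟩).toAlgEquiv.symm :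
      ((Rat.HeightOneSpectrum.primesEquiv (R := 𝓞 ℚ)).symm ⟨p, Fact.out⟩).adicCompletion ℚ
        ≃ₐ[ℚ] ℚ_[p])
  refine ⟨WeierstrassCurve.Affine.Point.map e R, fun h ↦ hR0 ?_, ?_⟩
  · exact WeierstrassCurve.Affine.Point.map_injective (f := e) (h.trans (map_zero _).symm)
  · rw [← map_nsmul, hRp, map_zero]

/-- **Hypothesis (iv) «`E(ℚ_p)[p] = 0`» FAILS** at a split multiplicative odd `p` carrying an
unramified rational line: the local-torsion-freeness consumed by the torsion-free control theorems
(Castella 2018 erratum Thm. 1.1 (iv); tree `X11b.LocalTorsion.localTorsion_eq_zero_of_mult` on the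
sub-row `¬split ∨ p ∤ v_p(Δ_min)`, `X2/MultControlAtomsNoLocalTorsion`) is false there.
[cite: Castella2018Erratum, Thm. 1.1 (iv) and Remark (pp. 1–2)] [cite: GreenbergVatsal2000, §2 pp. 14–15] -/
theorem not_noLocalPTorsion_of_lineUnramifiedAt_of_split (hp2 : p ≠ 2)
    (hsplit : W.HasSplitMultiplicativeReductionAtPrime p)
    {Φ : AddSubgroup (geomTorsion W (p : ℤ))} (hΦ : IsRationalLine W p Φ)
    (hunr : LineUnramifiedAt W p Φ) :
    ¬ ∀ R : (W.baseChange ℚ_[p]).toAffine.Point, p • R = 0 → R = 0 := by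
  obtain ⟨R, hR0, hRp⟩ := exists_localTorsion_ne_zero_of_lineUnramifiedAt_of_split hp2 hsplit hΦ hunr
  exact fun h ↦ hR0 (h R hRp)

/-- **Type A, off the barrier locus, SPLIT `p`: `E(ℚ_p)[p] ≠ 0`** (any analytic rank: the étale end
of an X2b OR an X2c class; the rational line exists by reducibility and is unramified-even off the
locus, `…EtaleEndAtP.lineUnramifiedAt_of_offLocus`). [cite: GreenbergVatsal2000, §2 pp. 14–15, p. 28] -/
theorem exists_localTorsion_ne_zero_of_notGVPar_offLocus_of_split (hp2 : p ≠ 2)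
    (hred : ¬ W.HasIrreducibleModPGaloisRep p) (hA : ¬ GVPar W p) (hoff : ¬ HasRamifiedOddLineAt W p)
    (hsplit : W.HasSplitMultiplicativeReductionAtPrime p) :
    ∃ R : (W.baseChange ℚ_[p]).toAffine.Point, R ≠ 0 ∧ p • R = 0 := by
  obtain ⟨Φ, hΦ⟩ := exists_isRationalLine_of_not_irr W p hred
  exact exists_localTorsion_ne_zero_of_lineUnramifiedAt_of_split hp2 hsplit hΦ
    (EisensteinPrimesMazurMCOnCellBEtaleEndAtP.lineUnramifiedAt_of_offLocus hA hoff hΦ).1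

/-- **Row B11: at a SPLIT X2c type-A étale end `E₀(ℚ_p)[p] ≠ 0`** (crux `BSDpOnCellC`, line `b1`: the
member at which the torsion-free control theorems are void). [cite: GreenbergVatsal2000, §2 pp. 14–15] -/
theorem exists_localTorsion_ne_zero_of_cellC_offLocus_of_split (hc : X2.CellC W p) (hA : ¬ GVPar W p)
    (hoff : ¬ HasRamifiedOddLineAt W p) (hsplit : W.HasSplitMultiplicativeReductionAtPrime p) :
    ∃ R : (W.baseChange ℚ_[p]).toAffine.Point, R ≠ 0 ∧ p • R = 0 :=
  exists_localTorsion_ne_zero_of_notGVPar_offLocus_of_split hc.2.1 hc.2.2.1 hA hoff hsplit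

/-- **The local `p`-torsion DICHOTOMY at an X2c type-A étale end: `E₀(ℚ_p)[p] ≠ 0 ⟺ p` is SPLIT**
(`⟹`: at a non-split multiplicative `p ≥ 3` every `E/ℚ` has `E(ℚ_p)[p] = 0`, tree
`X11b.LocalTorsion.localTorsion_eq_zero_of_nonsplit`). Row-B11 twin of
`…EtaleEndLocalSplitting.exists_localTorsion_ne_zero_iff_split_of_cellB_offLocus`.
[cite: SilvermanAEC2009, Thm VII.6.1 and Exercise 3.5] [cite: GreenbergVatsal2000, §2 pp. 14–15] -/
theorem exists_localTorsion_ne_zero_iff_split_of_cellC_offLocus (hc : X2.CellC W p) (hA : ¬ GVPar W p)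
    (hoff : ¬ HasRamifiedOddLineAt W p) :
    (∃ R : (W.baseChange ℚ_[p]).toAffine.Point, R ≠ 0 ∧ p • R = 0) ↔
      W.HasSplitMultiplicativeReductionAtPrime p := by
  refine ⟨fun ⟨R, hR0, hRp⟩ ↦ ?_, exists_localTorsion_ne_zero_of_cellC_offLocus_of_split hc hA hoff⟩
  by_contra hns
  have hp3 : 3 ≤ p := lt_of_le_of_ne hp.out.two_le (Ne.symm hc.2.1)
  exact hR0 (X11b.LocalTorsion.localTorsion_eq_zero_of_nonsplit W p hp3 hc.2.2.2 hns R hRp)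

/-- **Unramified rational line ⟹ (`E(ℚ_p)[p] ≠ 0 ⟺ p` split)** — the dichotomy in its rank-free,
cell-free form (multiplicative odd `p`). [cite: SilvermanAEC2009, Thm VII.6.1 and Exercise 3.5]
[cite: GreenbergVatsal2000, §2 pp. 14–15] -/
theorem exists_localTorsion_ne_zero_iff_split_of_lineUnramifiedAt (hp2 : p ≠ 2)
    (hmult : W.HasMultiplicativeReductionAtPrime p)
    {Φ : AddSubgroup (geomTorsion W (p : ℤ))} (hΦ : IsRationalLine W p Φ)
    (hunr : LineUnramifiedAt W p Φ) :
    (∃ R : (W.baseChange ℚ_[p]).toAffine.Point, R ≠ 0 ∧ p • R = 0) ↔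
      W.HasSplitMultiplicativeReductionAtPrime p := by
  refine ⟨fun ⟨R, hR0, hRp⟩ ↦ ?_,
    fun hsplit ↦ exists_localTorsion_ne_zero_of_lineUnramifiedAt_of_split hp2 hsplit hΦ hunr⟩
  by_contra hns
  have hp3 : 3 ≤ p := lt_of_le_of_ne hp.out.two_le (Ne.symm hp2)
  exact hR0 (X11b.LocalTorsion.localTorsion_eq_zero_of_nonsplit W p hp3 hmult hns R hRp)

end Summit.BirchSwinnertonDyer.BirchSwinnertonDyer.Theorems.EisensteinPrimesMazurMCOnCellBEtaleEndLocalTorsion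

end
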